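import Literature.IUT.HodgeArakelov.BadPrimeGaussianMonoidsProofs4

/-!
# [IUTchII] Cor 3.5 (ii)/(iii): Galois compatibility of the MONOID-sourced restriction isomorphism and of the
# diagonal isomorphism `Ψ_cns,0 ⥲ Ψ_cns,⟨F_l^⋇⟩` (the two optional one-liners of SUBDAG-IUTchII-Cor-35, W6-S7)

S. Mochizuki, *Inter-universal Teichmüller theory II*, kurims Dec-2020 manuscript, Cor 3.5 (ii) p. 95 ("each
`Ψ_ξ(M^Θ_*)` is equipped with a natural action by `G_v(M^Θ_*▶)_{⟨F_l^⋇⟩}` … the compatibility of the action … with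
the inclusions `G_v(M^Θ_*) ↪ Π_v▶(M^Θ_*▶)` determined by the various choices of the `D^δ_{t,μ_-}`"; Rmk 3.6.1 p. 101
"the «Galois compatibility» … corresponds precisely to the «Galois functoriality»") and Cor 3.5 (iii) p. 95 ("an
isomorphism of monoids `Ψ_cns(M^Θ_*)_0 ⥲ Ψ_cns(M^Θ_*)_{⟨F_l^⋇⟩}` that is compatible with the respective labeled
`G_v(M^Θ_*▶)`-actions") [cite: Mochizuki2012, Cor 3.5 (ii) p.95]. Claim key DISPUTED (D-0012). PROOF-ONLY
companion (abc-iut cell, layer L6, wave-5 seat abc-iut-w5-d086 = holder of record of sub-DAG row W6-S7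
«SUBDAG IUTchII:Cor3.5», plan/L6/SUBDAG-IUTchII-Cor-35.md — content by abc-iut-w5-d100 — whose census names
exactly these two clauses as "OPEN-as-decl (optional one-liners, no consumer yet)": rows Cor-35.ii.r10 /
Cor-35.iii.r13); nodes IUTchII:Cor3.5(ii), IUTchII:Cor3.5(iii). NO definition, NO `Prop` fact.

* `restrictionIso'_equivariant` — abc-iut-w4-d004's `restrictionIso_equivariant` (Proofs3, restriction typed
  out of the cohomology GROUP) restated for restriction morphisms typed OUT OF A SUBMONOID `S`
  (`r_t : S →* M`, the repaired junction typing of Proofs4, finding d017-F1-1): any isomorphism `e : S ⥲ S'`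
  whose underlying map IS the restriction `x ↦ (r_t x)_t` (Proofs4 `exists_restrictionIso'`,
  `exists_unique_restrictionIso'_thetaMonoid`) intertwines the `G_v`-action on `S` through any one section
  `s_{t₀}` with the DIAGONAL action `G_v,⟨F_l^⋇⟩` on the labeled copies — given equivariance of each `r_t`
  along `s_t` and conjugate synchronization on `S` (Cor 3.5 (i)).
* `coe_diagonalIso`, `diagonalIso_equivariant` — Cor 3.5 (iii): abc-iut-L6-t2's REAL `diagonalIso`
  (`GaussianMonoidsGood.lean`) intertwines an automorphism `e` of the constant monoid (the labeled
  `G_v`-action at one label) with the diagonal automorphism `piIso T e` of `∏_t Ψ_cns,t`.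
Nothing here asserts a disputed claim or takes a side on [IUTchIII] Cor 3.12; typed ≠ proved ≠ endorsed.
-/

namespace Literature.IUT.HodgeArakelov

namespace BadPrimeGaussianMonoids

universe u v w

/-! ### 1. Cor 3.5 (ii): Galois compatibility of a restriction isomorphism out of a submonoid -/

section Galois

variable {H : Type u} [CommGroup H] {T : Type v} {M : Type w} [CommMonoid M]
  {G : Type*} [Group G] {P : Type*} [Group P]
  (conj : P →* MulAut H) (s : T → (G →* P)) (β : G →* MulAut M)

/-- **IUTchII:Cor3.5(ii)** (kurims p.95; Rmk 3.6.1 p.101), MONOID-sourced form: let `S ⊆ H` be a submonoid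
stable under the `G_v`-actions through the sections `s_t : G_v → Π_X` (`hstab`), let the restriction morphisms
`r_t : S →* M` be equivariant along `s_t` (`hr`, "compatibility … with the inclusions … determined by the various
choices of the `D^δ_{t,μ_-}`") and let the actions AGREE on `S` (`hsync`, conjugate synchronization, Cor 3.5
(i)). Then any isomorphism `e : S ⥲ S'` whose underlying map is the restriction `x ↦ (r_t x)_t` is
`G_v`-equivariant for the action through `s_{t₀}` on `S` and the diagonal action `G_v,⟨F_l^⋇⟩` on `S' ⊆ ∏_t M`.
[claim: Mochizuki2012, status: disputed] [cite: Mochizuki2012, Cor 3.5 (ii) p.95] -/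
theorem restrictionIso'_equivariant (S : Submonoid H) (r : T → (S →* M))
    (hstab : ∀ g t, ∀ x ∈ S, conj (s t g) x ∈ S)
    (hr : ∀ (t : T) (g : G) (x : S), r t ⟨conj (s t g) x, hstab g t x x.2⟩ = β g (r t x))
    (hsync : ∀ g t t', ∀ x ∈ S, conj (s t g) x = conj (s t' g) x)
    {S' : Submonoid (T → M)} (e : S ≃* S') (he : ∀ x : S, ((e x : S') : T → M) = MonoidHom.pi r x)
    (t₀ : T) (g : G) (x : S) :
    ((e ⟨conj (s t₀ g) x, hstab g t₀ x x.2⟩ : S') : T → M) = piIso T (β g) (e x : T → M) := by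
  rw [he, he]
  funext t
  have hx : (⟨conj (s t₀ g) x, hstab g t₀ x x.2⟩ : S) = ⟨conj (s t g) x, hstab g t x x.2⟩ :=
    Subtype.ext (hsync g t₀ t x x.2)
  rw [MonoidHom.pi_apply, hx, hr]
  rfl

end Galois

/-! ### 2. Cor 3.5 (iii): the diagonal isomorphism `Ψ_cns,0 ⥲ Ψ_cns,⟨F_l^⋇⟩` is Galois compatible -/

section Diagonal

variable {T : Type u} {M : Type v} [CommMonoid M] [Nonempty T]

/-- The underlying family of `diagonalIso T M m` is the constant family `t ↦ m` (abc-iut-L6-t2's `diagonalIso`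
is the diagonal embedding onto its range). [folklore] -/
private theorem coe_diagonalIso (m : M) : ((diagonalIso T M m : diagonalSubmonoid T M) : T → M) = fun _ => m :=
  rfl

/-- **IUTchII:Cor3.5(iii)** (kurims p.95) "an isomorphism of monoids `Ψ_cns(M^Θ_*)_0 ⥲ Ψ_cns(M^Θ_*)_{⟨F_l^⋇⟩}` that
is compatible with the respective labeled `G_v(M^Θ_*▶)`-actions": for every automorphism `e` of the constant
monoid (the action of `g ∈ G_v` on the copy labelled `0`), the diagonal isomorphism intertwines `e` with the
diagonal automorphism `piIso T e` of `∏_{|t|} Ψ_cns,|t|` (the labeled action at every label — print's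
conjugate synchronization makes all labeled actions the same). [claim: Mochizuki2012, status: disputed]
[cite: Mochizuki2012, Cor 3.5 (iii) p.95] -/
theorem diagonalIso_equivariant (e : M ≃* M) (m : M) :
    ((diagonalIso T M (e m) : diagonalSubmonoid T M) : T → M) =
      piIso T e ((diagonalIso T M m : diagonalSubmonoid T M) : T → M) := by
  rw [coe_diagonalIso, coe_diagonalIso]
  rfl

/-! The submonoid-level form — `piIso T e` maps the diagonal onto itself — is abc-iut-w4-d004's
`map_piIso_diagonalSubmonoid` (Proofs2, for a general `N ≃* M`); not restated. -/

end Diagonal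

end BadPrimeGaussianMonoids

end Literature.IUT.HodgeArakelov
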